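import Literature.AlgebraicGeometry.HodgeTheory.AbelianVarietyCyclotomicAutomorphismWeilClasses
import Literature.AlgebraicGeometry.HodgeTheory.WeilClassesFieldProductsExceptional
import Literature.AlgebraicGeometry.HodgeTheory.WeilClassesFieldProducts
import Literature.AlgebraicGeometry.HodgeTheory.DegreeOneHodgeTypes
import HarnessLib

/-!
# Products: the diagonal cyclotomic automorphism `δ₁ × δ₂` of `A₁ × A₂` — the analytic type ADDS,
# `n_ζ(δ₁ × δ₂) = n_ζ(δ₁) + n_ζ(δ₂)` — and Moonen–Zarhin's §2 Example read on Zarhin's multiplicities: for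
# `2 dim A₁ / φ(m)` odd and Hom-orthogonal factors, a symmetric SUM of two (necessarily asymmetric) types yields
# EXCEPTIONAL Hodge classes in `W_{ℚ(ζ_m)}(A₁ × A₂)`

Family `hodge`, lane `lit-hodgefound` (seat p03, GEN 36 «Hodge classes from the analytic type of a cyclotomic
automorphism»), topic `Literature/AlgebraicGeometry/HodgeTheory`.  Theorems only: no definition, no instance, no named
fact (net Literature debt 0).  Junction BY NAME of GEN 35/36's analytic type `n_ζ(δ) = eigenMultiplicity A δ ζ` of an
endomorphism with `Φ_m(δ) = 0` (and g36-#1's reading of Moonen–Zarhin's Criterion for `F = ℚ(ζ_m)`) with the tree's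
product files `WeilClassesFieldProducts` (`W_F(A₁ × A₂) ⊗ ℂ ⊆ span {pr₁^* a ⌣ pr₂^* b}`; the product step for
algebraic and decomposable classes), `WeilClassesFieldProductsExceptional` (the §2 Example via the involution `(-1) ⊕ 1` of
the Lefschetz group) and `DegreeOneHodgeTypes` (`finrank_eigenspace_inf_hodgeOneZero_prod`: multiplicities add on
`H^{1,0}(A₁ × A₂) = pr₁^* H^{1,0}(A₁) ⊕ pr₂^* H^{1,0}(A₂)`).

## Sources, verbatim (held texts)

B. Moonen, Yu. Zarhin, *Weil classes on abelian varieties*, J. reine angew. Math. 496 (1998) = alg-geom/9612017, held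
`paper:arxiv-alg-geom_9612017`, §2 chunk p0002 L1–L13: «The condition that `1 ∈ F` acts as the identity implies that `F`
acts on each factor `Y_i^{m_i}`, and that the action of `F` on `X` is the “diagonal action” w.r.t. the decomposition.
Write `r_i = 2 m_i dim(Y_i)/[F:ℚ]`, so that `r = r₁ + ⋯ + r_k`»; L21–L31 «if `W_F(X)` consists of Hodge classes, then
`W_F(X)` consists of decomposable Hodge classes ⟺ each of the spaces `W_F(Y_i^{m_i})` consists of decomposable Hodge
classes»; L33–L38 «**Example.** Let `X = Y_1 × Y_2` where the ratios `2dim(Y_1)/[F:ℚ]` and `2dim(Y_2)/[F:ℚ]` are odd.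
Then non-zero elements of `W_F(Y_1)` and `W_F(Y_2)` are not Hodge classes and therefore all non-zero elements of
`W_F(X)` are exceptional Hodge classes. Shioda's example mentioned above is of this type. See also [SZ2].»; §1 chunk
p0001 L78–L81, L93–L97 (the multiplicities `n_σ`, Criterion).

Yu. G. Zarhin, *Jacobians with automorphisms of prime order*, MRR 2021 = arXiv:2109.06794, held `paper:arxiv-2109.06794`,
§1 Example 1.3 (chunk p0003 L88–L104): the diagonal automorphism `δ_3` of `Y = Y_1 × Y_2`, «`𝐚_Y(1) = f(1)`,
`𝐚_Y(2) = f(2)`» (multiplicities of a product are read block by block).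

J. S. Milne, *Lefschetz classes on abelian varieties*, Duke Math. J. 96 (1999), §1 Prop. 1.5, §3 p. 657, Thm. 4.4 (the
mechanism of the tree's `WeilClassesFieldProductsExceptional`).

## What is proved (namespace `Literature.AlgebraicGeometry.HodgeTheory.AbelianVariety`)

`Ψ = δ₁ × δ₂ := prodLift (fst ≫ δ₁) (snd ≫ δ₂)` on `A₁.prod A₂`; `hδᵢ : Φ_m(δᵢ) = 0`; `hrᵢ : φ(m)·rᵢ = 2 dim Aᵢ`.

* §1 THE DIAGONAL AUTOMORPHISM: `eval₂_cyclotomic_prodLift_eq_zero` (`Φ_m(δ₁ × δ₂) = 0`: the same cyclotomic field acts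
  diagonally), **`eigenMultiplicity_prodLift_eq_add`** (for ALL endomorphisms `δ₁, δ₂` and all `ζ`:
  `n_ζ(δ₁ × δ₂) = n_ζ(δ₁) + n_ζ(δ₂)` — Zarhin's additivity `𝐚_Y = 𝐚_{Y_1} + 𝐚_{Y_2}`), `totient_mul_add_eq_two_mul_dim_prod`
  (`φ(m)(r₁ + r₂) = 2 dim(A₁ × A₂)`: «`r = r₁ + ⋯ + r_k`»).
* §2 THE CRITERION ON THE PRODUCT: **`forall_isOfHodgeType_weilClassesField_cyclotomic_prodLift_iff`** (all of
  `W_{ℚ(ζ_m)}(A₁ × A₂) ⊗ ℂ ⊂ H^{r₁+r₂}` is Hodge ⟺ the SUM of the two types is symmetric,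
  `n_ζ(δ₁) + n_ζ(δ₂) = n_{ζ⁻¹}(δ₁) + n_{ζ⁻¹}(δ₂)` for all primitive `ζ`), `…_of_symmetric_of_symmetric` (two symmetric types
  give a symmetric sum), `exists_isRationalClass_isOfHodgeType_ne_zero_prodLift_iff`; the product steps
  `weilClassesField_cyclotomic_prodLift_le_algebraicClasses` / `…_le_divisorClassesSpan` (Weil classes of the factors
  algebraic / decomposable ⟹ those of the product).
* §3 MOONEN–ZARHIN'S §2 EXAMPLE FOR A CYCLOTOMIC ACTION (any `Ψ` on `A₁ × A₂` with `Φ_m(Ψ) = 0`, `Hom(A₁, A₂) = 0 =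
  Hom(A₂, A₁)`, `r₁ = 2 dim A₁/φ(m)` ODD, `r₁ + r₂ = 2k`): `weilClassesField_cyclotomic_prod_inf_divisorClassesSpan_eq_bot_of_odd`
  (`W ⊗ ℂ ∩ Dᵏ ⊗ ℂ = 0`), **`exists_exceptional_hodgeClass_of_cyclotomic_prod_of_odd`** (a SYMMETRIC type of `Ψ` ⟹ a
  non-zero RATIONAL Hodge class of type `(k, k)` in `W_{ℚ(ζ_m)}(A₁ × A₂)` OUTSIDE the divisor ring — an exceptional Hodge
  class), `forall_isOfHodgeType_and_not_mem_divisorClassesSpan_of_cyclotomic_prod_of_odd` («all non-zero elements of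
  `W_F(X)` are exceptional Hodge classes»), `not_isDivisorGenerated_of_cyclotomic_prod_of_odd` (`B^•(A₁ × A₂) ≠ D^•`);
  and for the DIAGONAL `Ψ = δ₁ × δ₂`: **`exists_exceptional_hodgeClass_of_cyclotomic_prodLift_of_odd`** — the factor types
  are asymmetric (`rᵢ` odd: «non-zero elements of `W_F(Y_i)` are not Hodge classes», g36-#1), yet a symmetric SUM
  `n_ζ(δ₁) + n_ζ(δ₂) = n_{ζ⁻¹}(δ₁) + n_{ζ⁻¹}(δ₂)` produces exceptional Hodge classes on the product.

Honesty clause: statements for a CLASS of pairs given by hypotheses; no particular product is constructed (Shioda's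
example is not formalized); no Weil class is shown algebraic or non-algebraic.

## References

* [MoonenZarhin1998WeilClasses] B. J. J. Moonen, Yu. G. Zarhin, *Weil classes on abelian varieties*, J. reine angew.
  Math. 496 (1998) 83–92 = arXiv:alg-geom/9612017, §2 (diagonal action, display, Example; chunk p0002 L1–L38), §1
  (chunk p0001).
* [Zarhin2021PrimeOrderJacobians] Yu. G. Zarhin, *Jacobians with automorphisms of prime order*, Math. Research Reports
  (2021), arXiv:2109.06794, §1 Example 1.3 (chunk p0003).
* [Milne1999LefschetzClasses] J. S. Milne, *Lefschetz classes on abelian varieties*, Duke Math. J. 96 (1999) 639–675,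
  §1 Prop. 1.5, §3 p. 657, Thm. 4.4.
* [vanGeemen1994HodgeAV] B. van Geemen, LNM 1594 (1994), 2.4–2.5 (`Dᵖ ⊆ Bᵖ`, exceptional classes), proof of Lemma 5.2 (3).
* [VoisinHodgeII2003] C. Voisin, *Hodge Theory and Complex Algebraic Geometry II* (2003), Prop. 9.20.
-/

noncomputable section

open CategoryTheory CategoryTheory.Limits Module Polynomial

namespace Literature.AlgebraicGeometry.HodgeTheory

namespace AbelianVariety

open Literature.AlgebraicTopology.SingularHomology
open Literature.AlgebraicGeometry.Motives (AlgPoints IsSmoothProjective)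
open Literature.Barriers.HodgeConjecture (divisorClassesSpan)

/-! ## §0 Private helpers -/

/-- `hodgeOneZero` depends only on the scheme, not on the numeral witnessing its dimension. [folklore] -/
private theorem hodgeOneZero_eq_of_eq₃₆ {X : Motives.SchemeOver ℂ} {N N' : ℕ} (hX : IsSmoothProjective N X)
    (hX' : IsSmoothProjective N' X) (h : N = N') : hodgeOneZero hX = hodgeOneZero hX' := by
  subst h
  rfl

/-- `Φ_m ∈ ℤ[X]` is irreducible over `ℚ`. [cite: MoonenZarhin1998WeilClasses, §1 (chunk p0001 L32–L41)] -/
private theorem irreducible_cyclotomic_int_map_rat₃₆ {m : ℕ} (hm : 0 < m) :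
    Irreducible ((cyclotomic m ℤ).map (Int.castRingHom ℚ)) := by
  rw [map_cyclotomic]
  exact cyclotomic.irreducible_rat hm

/-! ## §1 The diagonal automorphism `δ₁ × δ₂`: `Φ_m(δ₁ × δ₂) = 0`, `n_ζ(δ₁ × δ₂) = n_ζ(δ₁) + n_ζ(δ₂)` -/

section Diagonal

variable {A₁ A₂ : Motives.AbelianVariety ℂ} {δ₁ : A₁ ⟶ A₁} {δ₂ : A₂ ⟶ A₂} {m r₁ r₂ : ℕ}

/-- **`Φ_m(δ₁) = 0`, `Φ_m(δ₂) = 0` ⟹ `Φ_m(δ₁ × δ₂) = 0`**: the cyclotomic field `ℚ(ζ_m)` acts DIAGONALLY on `A₁ × A₂`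
(«the action of `F` on `X` is the “diagonal action” w.r.t. the decomposition»).
[cite: MoonenZarhin1998WeilClasses, §2 (chunk p0002 L1–L13)] [cite: Zarhin2021PrimeOrderJacobians, §1 Example 1.3 (chunk p0003 L96–L101)] -/
theorem eval₂_cyclotomic_prodLift_eq_zero
    (hδ₁ : (cyclotomic m ℤ).eval₂ (Int.castRingHom (End A₁)) (End.of δ₁) = 0)
    (hδ₂ : (cyclotomic m ℤ).eval₂ (Int.castRingHom (End A₂)) (End.of δ₂) = 0) :
    (cyclotomic m ℤ).eval₂ (Int.castRingHom (End (A₁.prod A₂)))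
      (End.of (Motives.AbelianVariety.prodLift (Motives.AbelianVariety.fst A₁ A₂ ≫ δ₁)
        (Motives.AbelianVariety.snd A₁ A₂ ≫ δ₂))) = 0 :=
  eval₂_prodLift_fst_snd_eq_zero (Motives.AbelianVariety.prodLift_fst _ _) (Motives.AbelianVariety.prodLift_snd _ _)
    hδ₁ hδ₂

/-- **THE ANALYTIC TYPE ADDS: `n_ζ(δ₁ × δ₂) = n_ζ(δ₁) + n_ζ(δ₂)`** for all endomorphisms `δ₁`, `δ₂` and every `ζ ∈ ℂ`
(`H^{1,0}(A₁ × A₂) = pr₁^* H^{1,0}(A₁) ⊕ pr₂^* H^{1,0}(A₂)` equivariantly; Zarhin's `𝐚_Y(h) = 𝐚_{Y_1}(h) + 𝐚_{Y_2}(h)` for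
`δ_3 = (δ_E on Y_1, δ_E⁻¹ on Y_2)`). [cite: Zarhin2021PrimeOrderJacobians, §1 Example 1.3 (chunk p0003 L88–L104)]
[cite: vanGeemen1994HodgeAV, proof of Lemma 5.2 (3)] [cite: MoonenZarhin1998WeilClasses, §2 (chunk p0002 L1–L13)] -/
theorem eigenMultiplicity_prodLift_eq_add (δ₁ : A₁ ⟶ A₁) (δ₂ : A₂ ⟶ A₂) (ζ : ℂ) :
    eigenMultiplicity (A₁.prod A₂) (Motives.AbelianVariety.prodLift (Motives.AbelianVariety.fst A₁ A₂ ≫ δ₁)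
        (Motives.AbelianVariety.snd A₁ A₂ ≫ δ₂)) ζ =
      eigenMultiplicity A₁ δ₁ ζ + eigenMultiplicity A₂ δ₂ ζ := by
  have h := finrank_eigenspace_inf_hodgeOneZero_prod (rfl : A₁.dim = A₁.dim) (rfl : A₂.dim = A₂.dim) δ₁ δ₂ ζ
  change finrank ℂ _ = eigenMultiplicity A₁ δ₁ ζ + eigenMultiplicity A₂ δ₂ ζ at h
  rw [← h, eigenMultiplicity,
    hodgeOneZero_eq_of_eq₃₆ (Motives.AbelianVariety.isSmoothProjective_holds (A := A₁.prod A₂))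
      (Motives.isSmoothProjective_of_dim_eq'
        (Motives.AbelianVariety.dim_prod A₁ A₂)) (Motives.AbelianVariety.dim_prod A₁ A₂)]

/-- **`φ(m) · (r₁ + r₂) = 2 dim(A₁ × A₂)`** («`r = r₁ + ⋯ + r_k`»): the Weil classes of the product live in degree `r₁ + r₂`.
[cite: MoonenZarhin1998WeilClasses, §2 (chunk p0002 L8–L10)] -/
theorem totient_mul_add_eq_two_mul_dim_prod (hr₁ : Nat.totient m * r₁ = 2 * A₁.dim)
    (hr₂ : Nat.totient m * r₂ = 2 * A₂.dim) : Nat.totient m * (r₁ + r₂) = 2 * (A₁.prod A₂).dim := by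
  rw [Motives.AbelianVariety.dim_prod, mul_add, hr₁, hr₂]
  ring

end Diagonal

/-! ## §2 The criterion on the product: symmetric SUM of the two types -/

section Criterion

variable {A₁ A₂ : Motives.AbelianVariety ℂ} {δ₁ : A₁ ⟶ A₁} {δ₂ : A₂ ⟶ A₂} {m r₁ r₂ : ℕ}

/-- **All of `W_{ℚ(ζ_m)}(A₁ × A₂) ⊗ ℂ ⊂ H^{r₁+r₂}` is Hodge ⟺ the SUM of the types is symmetric**:
`n_ζ(δ₁) + n_ζ(δ₂) = n_{ζ⁻¹}(δ₁) + n_{ζ⁻¹}(δ₂)` for every primitive `m`-th root `ζ` (Moonen–Zarhin's Criterion for the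
diagonal action; two symmetric types suffice, two asymmetric ones may compensate).
[cite: MoonenZarhin1998WeilClasses, §1 Criterion (chunk p0001 L93–L97) and §2 (chunk p0002 L1–L13)] -/
theorem forall_isOfHodgeType_weilClassesField_cyclotomic_prodLift_iff (hm : 0 < m)
    (hδ₁ : (cyclotomic m ℤ).eval₂ (Int.castRingHom (End A₁)) (End.of δ₁) = 0)
    (hδ₂ : (cyclotomic m ℤ).eval₂ (Int.castRingHom (End A₂)) (End.of δ₂) = 0)
    (hr₁ : Nat.totient m * r₁ = 2 * A₁.dim) (hr₂ : Nat.totient m * r₂ = 2 * A₂.dim) :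
    (∀ c ∈ weilClassesField (A₁.prod A₂) (Motives.AbelianVariety.prodLift (Motives.AbelianVariety.fst A₁ A₂ ≫ δ₁)
        (Motives.AbelianVariety.snd A₁ A₂ ≫ δ₂)) (cyclotomic m ℤ) (r₁ + r₂),
        IsOfHodgeType (A₁.prod A₂).dim (A₁.prod A₂).X (r₁ + r₂) ((r₁ + r₂) / 2) ((r₁ + r₂) / 2) c) ↔
      ∀ ζ : ℂ, IsPrimitiveRoot ζ m →
        eigenMultiplicity A₁ δ₁ ζ + eigenMultiplicity A₂ δ₂ ζ =
          eigenMultiplicity A₁ δ₁ ζ⁻¹ + eigenMultiplicity A₂ δ₂ ζ⁻¹ := by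
  rw [forall_isOfHodgeType_weilClassesField_cyclotomic_iff hm (eval₂_cyclotomic_prodLift_eq_zero hδ₁ hδ₂)
    (totient_mul_add_eq_two_mul_dim_prod hr₁ hr₂)]
  refine forall₂_congr fun ζ _ ↦ ?_
  rw [eigenMultiplicity_prodLift_eq_add, eigenMultiplicity_prodLift_eq_add]

/-- **Two symmetric types give Hodge Weil classes on the product**: if `n_ζ(δᵢ) = n_{ζ⁻¹}(δᵢ)` for `i = 1, 2` and all
primitive `ζ`, every class of `W_{ℚ(ζ_m)}(A₁ × A₂) ⊗ ℂ` is of type `((r₁+r₂)/2, (r₁+r₂)/2)`.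
[cite: MoonenZarhin1998WeilClasses, §1 Criterion (chunk p0001 L93–L97) and §2 (chunk p0002 L1–L13)] -/
theorem forall_isOfHodgeType_weilClassesField_cyclotomic_prodLift_of_symmetric (hm : 0 < m)
    (hδ₁ : (cyclotomic m ℤ).eval₂ (Int.castRingHom (End A₁)) (End.of δ₁) = 0)
    (hδ₂ : (cyclotomic m ℤ).eval₂ (Int.castRingHom (End A₂)) (End.of δ₂) = 0)
    (hr₁ : Nat.totient m * r₁ = 2 * A₁.dim) (hr₂ : Nat.totient m * r₂ = 2 * A₂.dim)
    (hsym₁ : ∀ ζ : ℂ, IsPrimitiveRoot ζ m → eigenMultiplicity A₁ δ₁ ζ = eigenMultiplicity A₁ δ₁ ζ⁻¹)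
    (hsym₂ : ∀ ζ : ℂ, IsPrimitiveRoot ζ m → eigenMultiplicity A₂ δ₂ ζ = eigenMultiplicity A₂ δ₂ ζ⁻¹) :
    ∀ c ∈ weilClassesField (A₁.prod A₂) (Motives.AbelianVariety.prodLift (Motives.AbelianVariety.fst A₁ A₂ ≫ δ₁)
        (Motives.AbelianVariety.snd A₁ A₂ ≫ δ₂)) (cyclotomic m ℤ) (r₁ + r₂),
      IsOfHodgeType (A₁.prod A₂).dim (A₁.prod A₂).X (r₁ + r₂) ((r₁ + r₂) / 2) ((r₁ + r₂) / 2) c :=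
  (forall_isOfHodgeType_weilClassesField_cyclotomic_prodLift_iff hm hδ₁ hδ₂ hr₁ hr₂).2
    fun ζ hζ ↦ by rw [hsym₁ ζ hζ, hsym₂ ζ hζ]

/-- **A non-zero rational Hodge class in `W_{ℚ(ζ_m)}(A₁ × A₂) ⊗ ℂ` exists iff the sum of the types is symmetric**
(`r₁ + r₂ ≠ 0`). [cite: MoonenZarhin1998WeilClasses, §1 Criterion and «all or nothing» (chunk p0001 L57–L63, L93–L97), §2 (chunk p0002)] -/
theorem exists_isRationalClass_isOfHodgeType_ne_zero_prodLift_iff (hm : 0 < m)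
    (hδ₁ : (cyclotomic m ℤ).eval₂ (Int.castRingHom (End A₁)) (End.of δ₁) = 0)
    (hδ₂ : (cyclotomic m ℤ).eval₂ (Int.castRingHom (End A₂)) (End.of δ₂) = 0)
    (hr₁ : Nat.totient m * r₁ = 2 * A₁.dim) (hr₂ : Nat.totient m * r₂ = 2 * A₂.dim) (hr0 : r₁ + r₂ ≠ 0) :
    (∃ γ ∈ weilClassesField (A₁.prod A₂) (Motives.AbelianVariety.prodLift (Motives.AbelianVariety.fst A₁ A₂ ≫ δ₁)
        (Motives.AbelianVariety.snd A₁ A₂ ≫ δ₂)) (cyclotomic m ℤ) (r₁ + r₂),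
        IsRationalClass γ ∧
          IsOfHodgeType (A₁.prod A₂).dim (A₁.prod A₂).X (r₁ + r₂) ((r₁ + r₂) / 2) ((r₁ + r₂) / 2) γ ∧ γ ≠ 0) ↔
      ∀ ζ : ℂ, IsPrimitiveRoot ζ m →
        eigenMultiplicity A₁ δ₁ ζ + eigenMultiplicity A₂ δ₂ ζ =
          eigenMultiplicity A₁ δ₁ ζ⁻¹ + eigenMultiplicity A₂ δ₂ ζ⁻¹ := by
  rw [exists_isRationalClass_isOfHodgeType_ne_zero_cyclotomic_iff hm (eval₂_cyclotomic_prodLift_eq_zero hδ₁ hδ₂)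
    (totient_mul_add_eq_two_mul_dim_prod hr₁ hr₂) hr0]
  refine forall₂_congr fun ζ _ ↦ ?_
  rw [eigenMultiplicity_prodLift_eq_add, eigenMultiplicity_prodLift_eq_add]

/-- **The product step, algebraic classes**: if `W_{ℚ(ζ_m)}(A₁) ⊗ ℂ ⊂ H^{2m₁}` and `W_{ℚ(ζ_m)}(A₂) ⊗ ℂ ⊂ H^{2m₂}` are
algebraic, so is `W_{ℚ(ζ_m)}(A₁ × A₂) ⊗ ℂ ⊂ H^{2(m₁+m₂)}` (exterior products of algebraic classes).
[cite: MoonenZarhin1998WeilClasses, §2 (chunk p0002 L1–L31)] [cite: VoisinHodgeII2003, Prop. 9.20] -/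
theorem weilClassesField_cyclotomic_prodLift_le_algebraicClasses {m₁ m₂ : ℕ} (hm : 0 < m)
    (hδ₁ : (cyclotomic m ℤ).eval₂ (Int.castRingHom (End A₁)) (End.of δ₁) = 0)
    (hδ₂ : (cyclotomic m ℤ).eval₂ (Int.castRingHom (End A₂)) (End.of δ₂) = 0)
    (hm₁ : Nat.totient m * (2 * m₁) = 2 * A₁.dim) (hm₂ : Nat.totient m * (2 * m₂) = 2 * A₂.dim)
    (hW₁ : weilClassesField A₁ δ₁ (cyclotomic m ℤ) (2 * m₁) ≤ algebraicClasses A₁.X m₁)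
    (hW₂ : weilClassesField A₂ δ₂ (cyclotomic m ℤ) (2 * m₂) ≤ algebraicClasses A₂.X m₂) :
    weilClassesField (A₁.prod A₂) (Motives.AbelianVariety.prodLift (Motives.AbelianVariety.fst A₁ A₂ ≫ δ₁)
        (Motives.AbelianVariety.snd A₁ A₂ ≫ δ₂)) (cyclotomic m ℤ) (2 * (m₁ + m₂)) ≤
      algebraicClasses (A₁.prod A₂).X (m₁ + m₂) :=
  weilClassesField_prod_le_algebraicClasses (Motives.AbelianVariety.prodLift_fst _ _)
    (Motives.AbelianVariety.prodLift_snd _ _) (cyclotomic.monic m ℤ) (natDegree_cyclotomic m ℤ)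
    (irreducible_cyclotomic_int_map_rat₃₆ hm) hδ₁ hδ₂ hm₁ hm₂ hW₁ hW₂

/-- **The product step, decomposable classes** («⟸» of «`W_F(X)` decomposable ⟺ each `W_F(Y_i^{m_i})` decomposable»):
`W(Aᵢ) ⊗ ℂ ⊆ D(Aᵢ) ⊗ ℂ` for `i = 1, 2` ⟹ `W(A₁ × A₂) ⊗ ℂ ⊆ D(A₁ × A₂) ⊗ ℂ`.
[cite: MoonenZarhin1998WeilClasses, §2 (chunk p0002 L21–L31)] [cite: vanGeemen1994HodgeAV, §2.4] -/
theorem weilClassesField_cyclotomic_prodLift_le_divisorClassesSpan {m₁ m₂ : ℕ} (hm : 0 < m)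
    (hδ₁ : (cyclotomic m ℤ).eval₂ (Int.castRingHom (End A₁)) (End.of δ₁) = 0)
    (hδ₂ : (cyclotomic m ℤ).eval₂ (Int.castRingHom (End A₂)) (End.of δ₂) = 0)
    (hm₁ : Nat.totient m * (2 * m₁) = 2 * A₁.dim) (hm₂ : Nat.totient m * (2 * m₂) = 2 * A₂.dim)
    (hW₁ : weilClassesField A₁ δ₁ (cyclotomic m ℤ) (2 * m₁) ≤ divisorClassesSpan A₁.X A₁.dim m₁)
    (hW₂ : weilClassesField A₂ δ₂ (cyclotomic m ℤ) (2 * m₂) ≤ divisorClassesSpan A₂.X A₂.dim m₂) :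
    weilClassesField (A₁.prod A₂) (Motives.AbelianVariety.prodLift (Motives.AbelianVariety.fst A₁ A₂ ≫ δ₁)
        (Motives.AbelianVariety.snd A₁ A₂ ≫ δ₂)) (cyclotomic m ℤ) (2 * (m₁ + m₂)) ≤
      divisorClassesSpan (A₁.prod A₂).X (A₁.prod A₂).dim (m₁ + m₂) :=
  weilClassesField_prod_le_divisorClassesSpan (Motives.AbelianVariety.prodLift_fst _ _)
    (Motives.AbelianVariety.prodLift_snd _ _) (cyclotomic.monic m ℤ) (natDegree_cyclotomic m ℤ)
    (irreducible_cyclotomic_int_map_rat₃₆ hm) hδ₁ hδ₂ hm₁ hm₂ hW₁ hW₂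

end Criterion

/-! ## §3 Moonen–Zarhin's §2 Example for a cyclotomic action: odd `2 dim A₁/φ(m)`, exceptional Hodge classes -/

section Exceptional

variable {A₁ A₂ : Motives.AbelianVariety ℂ} {Ψ : A₁.prod A₂ ⟶ A₁.prod A₂} {δ₁ : A₁ ⟶ A₁} {δ₂ : A₂ ⟶ A₂}
  {m r₁ r₂ k : ℕ}

/-- **`W_{ℚ(ζ_m)}(A₁ × A₂) ⊗ ℂ ∩ Dᵏ ⊗ ℂ = 0` for odd `r₁ = 2 dim A₁/φ(m)`** (any `Ψ` with `Φ_m(Ψ) = 0` on a product of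
Hom-orthogonal factors, `r₁ + r₂ = 2k`): the involution `(-1) ⊕ 1` of the Lefschetz group acts by `-1` on the Weil
classes and by `+1` on the divisor ring. [cite: MoonenZarhin1998WeilClasses, §2 Example (chunk p0002 L33–L38)]
[cite: Milne1999LefschetzClasses, §1 Prop. 1.5, §3 p. 657, Thm. 4.4] -/
theorem weilClassesField_cyclotomic_prod_inf_divisorClassesSpan_eq_bot_of_odd (hAB : ∀ f : A₁ ⟶ A₂, f = 0)
    (hBA : ∀ g : A₂ ⟶ A₁, g = 0) (hm : 0 < m)
    (hΨ : (cyclotomic m ℤ).eval₂ (Int.castRingHom (End (A₁.prod A₂))) (End.of Ψ) = 0)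
    (hr₁ : Nat.totient m * r₁ = 2 * A₁.dim) (hr₂ : Nat.totient m * r₂ = 2 * A₂.dim) (hodd : Odd r₁)
    (hk : r₁ + r₂ = 2 * k) :
    weilClassesField (A₁.prod A₂) Ψ (cyclotomic m ℤ) (2 * k) ⊓
      divisorClassesSpan (A₁.prod A₂).X (A₁.prod A₂).dim k = ⊥ :=
  weilClassesField_prod_inf_divisorClassesSpan_eq_bot_of_odd hAB hBA (cyclotomic.monic m ℤ) (natDegree_cyclotomic m ℤ)
    (irreducible_cyclotomic_int_map_rat₃₆ hm) hΨ hr₁ hr₂ hodd hk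

/-- **AN EXCEPTIONAL HODGE CLASS FROM A SYMMETRIC TYPE ON A PRODUCT**: `Ψ` with `Φ_m(Ψ) = 0` on `A₁ × A₂`,
`Hom(A₁, A₂) = 0 = Hom(A₂, A₁)`, `r₁` odd, `r₁ + r₂ = 2k`, and `n_ζ(Ψ) = n_{ζ⁻¹}(Ψ)` for every primitive `ζ` ⟹ there is
a non-zero RATIONAL class of Hodge type `(k, k)` in `W_{ℚ(ζ_m)}(A₁ × A₂) ⊗ ℂ` which is NOT in the divisor ring `Dᵏ ⊗ ℂ`
(«all non-zero elements of `W_F(X)` are exceptional Hodge classes. Shioda's example mentioned above is of this type»).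
[cite: MoonenZarhin1998WeilClasses, §2 Example (chunk p0002 L33–L38)] [cite: vanGeemen1994HodgeAV, 2.4–2.5] -/
theorem exists_exceptional_hodgeClass_of_cyclotomic_prod_of_odd (hAB : ∀ f : A₁ ⟶ A₂, f = 0)
    (hBA : ∀ g : A₂ ⟶ A₁, g = 0) (hm : 0 < m)
    (hΨ : (cyclotomic m ℤ).eval₂ (Int.castRingHom (End (A₁.prod A₂))) (End.of Ψ) = 0)
    (hr₁ : Nat.totient m * r₁ = 2 * A₁.dim) (hr₂ : Nat.totient m * r₂ = 2 * A₂.dim) (hodd : Odd r₁)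
    (hk : r₁ + r₂ = 2 * k)
    (hsym : ∀ ζ : ℂ, IsPrimitiveRoot ζ m →
      eigenMultiplicity (A₁.prod A₂) Ψ ζ = eigenMultiplicity (A₁.prod A₂) Ψ ζ⁻¹) :
    ∃ c ∈ weilClassesField (A₁.prod A₂) Ψ (cyclotomic m ℤ) (2 * k), IsRationalClass c ∧
      IsOfHodgeType (A₁.prod A₂).dim (A₁.prod A₂).X (2 * k) k k c ∧ c ≠ 0 ∧
        c ∉ divisorClassesSpan (A₁.prod A₂).X (A₁.prod A₂).dim k :=
  exists_isRationalClass_isOfHodgeType_not_mem_divisorClassesSpan_prod_of_odd hAB hBA (cyclotomic.monic m ℤ)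
    (natDegree_cyclotomic m ℤ) (irreducible_cyclotomic_int_map_rat₃₆ hm) hΨ hr₁ hr₂ hodd hk
    ((forall_root_eigenMultiplicity_eq_conj_iff hm).2 hsym)

/-- **«All non-zero elements of `W_F(X)` are exceptional Hodge classes»** (same hypotheses): every non-zero class of
`W_{ℚ(ζ_m)}(A₁ × A₂) ⊗ ℂ` is of type `(k, k)` and lies outside `Dᵏ ⊗ ℂ`.
[cite: MoonenZarhin1998WeilClasses, §2 Example (chunk p0002 L33–L38)] -/
theorem forall_isOfHodgeType_and_not_mem_divisorClassesSpan_of_cyclotomic_prod_of_odd (hAB : ∀ f : A₁ ⟶ A₂, f = 0)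
    (hBA : ∀ g : A₂ ⟶ A₁, g = 0) (hm : 0 < m)
    (hΨ : (cyclotomic m ℤ).eval₂ (Int.castRingHom (End (A₁.prod A₂))) (End.of Ψ) = 0)
    (hr₁ : Nat.totient m * r₁ = 2 * A₁.dim) (hr₂ : Nat.totient m * r₂ = 2 * A₂.dim) (hodd : Odd r₁)
    (hk : r₁ + r₂ = 2 * k)
    (hsym : ∀ ζ : ℂ, IsPrimitiveRoot ζ m →
      eigenMultiplicity (A₁.prod A₂) Ψ ζ = eigenMultiplicity (A₁.prod A₂) Ψ ζ⁻¹) :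
    ∀ c ∈ weilClassesField (A₁.prod A₂) Ψ (cyclotomic m ℤ) (2 * k), c ≠ 0 →
      IsOfHodgeType (A₁.prod A₂).dim (A₁.prod A₂).X (2 * k) k k c ∧
        c ∉ divisorClassesSpan (A₁.prod A₂).X (A₁.prod A₂).dim k :=
  forall_isOfHodgeType_and_not_mem_divisorClassesSpan_of_mem_weilClassesField_prod_of_odd hAB hBA (cyclotomic.monic m ℤ)
    (natDegree_cyclotomic m ℤ) (irreducible_cyclotomic_int_map_rat₃₆ hm) hΨ hr₁ hr₂ hodd hk
    ((forall_root_eigenMultiplicity_eq_conj_iff hm).2 hsym)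

/-- **`B^•(A₁ × A₂) ≠ D^•(A₁ × A₂)`** under the same hypotheses: the product is not divisor-generated.
[cite: MoonenZarhin1998WeilClasses, §2 Example (chunk p0002 L33–L38)] [cite: vanGeemen1994HodgeAV, 2.4–2.5] -/
theorem not_isDivisorGenerated_of_cyclotomic_prod_of_odd (hAB : ∀ f : A₁ ⟶ A₂, f = 0) (hBA : ∀ g : A₂ ⟶ A₁, g = 0)
    (hm : 0 < m) (hΨ : (cyclotomic m ℤ).eval₂ (Int.castRingHom (End (A₁.prod A₂))) (End.of Ψ) = 0)
    (hr₁ : Nat.totient m * r₁ = 2 * A₁.dim) (hr₂ : Nat.totient m * r₂ = 2 * A₂.dim) (hodd : Odd r₁)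
    (hk : r₁ + r₂ = 2 * k)
    (hsym : ∀ ζ : ℂ, IsPrimitiveRoot ζ m →
      eigenMultiplicity (A₁.prod A₂) Ψ ζ = eigenMultiplicity (A₁.prod A₂) Ψ ζ⁻¹) :
    ¬ IsDivisorGenerated (A₁.prod A₂) :=
  not_isDivisorGenerated_prod_of_odd hAB hBA (cyclotomic.monic m ℤ) (natDegree_cyclotomic m ℤ)
    (irreducible_cyclotomic_int_map_rat₃₆ hm) hΨ hr₁ hr₂ hodd hk ((forall_root_eigenMultiplicity_eq_conj_iff hm).2 hsym)

/-- **THE DIAGONAL CASE `Ψ = δ₁ × δ₂`, as in the printed Example**: `Φ_m(δᵢ) = 0`, `r₁ = 2 dim A₁/φ(m)` ODD (so that,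
by admissibility `n_ζ(δ₁) + n_{ζ⁻¹}(δ₁) = r₁`, the type of `δ₁` is asymmetric and «non-zero elements of `W_F(Y_1)` are not
Hodge classes», likewise for `Y_2`), Hom-orthogonal factors, `r₁ + r₂ = 2k`: if the SUM of the two types is symmetric,
`n_ζ(δ₁) + n_ζ(δ₂) = n_{ζ⁻¹}(δ₁) + n_{ζ⁻¹}(δ₂)` for all primitive `ζ`, then `W_{ℚ(ζ_m)}(A₁ × A₂)` contains a non-zero
rational Hodge class of type `(k, k)` outside the divisor ring. [cite: MoonenZarhin1998WeilClasses, §2 Example (chunk p0002 L33–L38)]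
[cite: Zarhin2021PrimeOrderJacobians, §1 Example 1.3 (chunk p0003 L88–L104)] -/
theorem exists_exceptional_hodgeClass_of_cyclotomic_prodLift_of_odd (hAB : ∀ f : A₁ ⟶ A₂, f = 0)
    (hBA : ∀ g : A₂ ⟶ A₁, g = 0) (hm : 0 < m)
    (hδ₁ : (cyclotomic m ℤ).eval₂ (Int.castRingHom (End A₁)) (End.of δ₁) = 0)
    (hδ₂ : (cyclotomic m ℤ).eval₂ (Int.castRingHom (End A₂)) (End.of δ₂) = 0)
    (hr₁ : Nat.totient m * r₁ = 2 * A₁.dim) (hr₂ : Nat.totient m * r₂ = 2 * A₂.dim) (hodd : Odd r₁)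
    (hk : r₁ + r₂ = 2 * k)
    (hsym : ∀ ζ : ℂ, IsPrimitiveRoot ζ m →
      eigenMultiplicity A₁ δ₁ ζ + eigenMultiplicity A₂ δ₂ ζ =
        eigenMultiplicity A₁ δ₁ ζ⁻¹ + eigenMultiplicity A₂ δ₂ ζ⁻¹) :
    ∃ c ∈ weilClassesField (A₁.prod A₂) (Motives.AbelianVariety.prodLift (Motives.AbelianVariety.fst A₁ A₂ ≫ δ₁)
        (Motives.AbelianVariety.snd A₁ A₂ ≫ δ₂)) (cyclotomic m ℤ) (2 * k), IsRationalClass c ∧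
      IsOfHodgeType (A₁.prod A₂).dim (A₁.prod A₂).X (2 * k) k k c ∧ c ≠ 0 ∧
        c ∉ divisorClassesSpan (A₁.prod A₂).X (A₁.prod A₂).dim k :=
  exists_exceptional_hodgeClass_of_cyclotomic_prod_of_odd hAB hBA hm (eval₂_cyclotomic_prodLift_eq_zero hδ₁ hδ₂) hr₁ hr₂
    hodd hk fun ζ hζ ↦ by rw [eigenMultiplicity_prodLift_eq_add, eigenMultiplicity_prodLift_eq_add, hsym ζ hζ]

/-- In the diagonal Example the FACTORS carry no non-zero rational Hodge class in their own Weil spaces (`rᵢ` odd —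
«non-zero elements of `W_F(Y_1)` and `W_F(Y_2)` are not Hodge classes»), while the product does: the contrast of the
printed Example, first half, for `A₁`. [cite: MoonenZarhin1998WeilClasses, §2 Example (chunk p0002 L33–L38)] -/
theorem eq_zero_of_mem_weilClassesField_cyclotomic_factor_of_odd (hm : 0 < m)
    (hδ₁ : (cyclotomic m ℤ).eval₂ (Int.castRingHom (End A₁)) (End.of δ₁) = 0)
    (hr₁ : Nat.totient m * r₁ = 2 * A₁.dim) (hodd : Odd r₁) {c : complexBetti A₁.X r₁}
    (hc : c ∈ weilClassesField A₁ δ₁ (cyclotomic m ℤ) r₁) (hcQ : IsRationalClass c)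
    (hcH : IsOfHodgeType A₁.dim A₁.X r₁ (r₁ / 2) (r₁ / 2) c) : c = 0 :=
  eq_zero_of_mem_weilClassesField_cyclotomic_of_odd hm hδ₁ hr₁ hodd hc hcQ hcH

end Exceptional

end AbelianVariety

end Literature.AlgebraicGeometry.HodgeTheory

end
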